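import Literature.MathematicalPhysics.QuantumFieldTheory.Balaban1983to89.B10SectAGathering
import Literature.MathematicalPhysics.QuantumFieldTheory.Balaban1983to89.B10SectCExpansion
import Literature.MathematicalPhysics.QuantumFieldTheory.Balaban1983to89.B10LogDet63

/-!
# `Balaban1985CMP102.SectC` — T. Bałaban, *Ultraviolet stability of three-dimensional lattice pure gauge field
# theories*, Commun. Math. Phys. **102** (1985) 255–275 [Balaban1985UV3], **Sect. C «Renormalization Transformation
# Preserves The Form of the Inductive Inequality», pp. 267–272, displays (48)–(63) and Theorem 2, AS PRINTED**
# (lane `pub-balaban3d`, spine typer 2; statements only — `def … : Prop` over carriers that NAME the printed objects,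
# every hypothesis a binder; one piece of [folklore] exponent bookkeeping, `bound55_of_displays`, knits the displays to
# the existing leaf `B10SectAGathering.Bound55`; nothing printed is asserted)

HONEST FRAMING (PLAN.md §0 of the lane, binding).  [Balaban1985UV3] proves, for the Wilson lattice approximation of pure
Yang–Mills in d = 3 with a compact semisimple G on a finite torus, the ultraviolet-stability bounds (5) p. 256 (Thm 1
p. 257) through the inductive inequalities (41) p. 266 / (47) p. 267 (Thm 2 p. 272).  NOT a continuum limit, NOT infinite
volume, NOT a mass gap, NOT d = 4, NOT the Clay problem.  Author's caveat p. 257 L20–21: «the proof is very sketchy and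
we do not discuss many technical details».  Every display below is a HYPOTHESIS-SHAPED `Prop`; provers of the lane
inhabit the carriers concretely (PLAN §3 p1) and prove the displays modulo the printed inputs b5–b9, b11 (PLAN §2).

PRIMARY TEXT.  PDF `paper:balaban1985-cmp102-uv-stability-3d` (journal page = PDF page + 254).  Every token quoted «…»
below was read by this seat on the page RENDERS `run/shared/lean/pub/pub-balaban/b2b-balaban-ref1/pages/
1985-cmp102-uv-stability-3d/1985-cmp102-uv-stability-3d-p013…p018-x2.png` (pp. 267–272) as images; line numbers «Lnn»
count printed lines of the journal page from the top, displays counted as lines, running head excluded (referee F-8: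
±1 against a text-only count).  Misprints are marked ⟦sic: …⟧.

WHAT THE TREE ALREADY TYPES (RE-USED BY NAME, not restated — lane rule PLAN §0.6; LQB = `Literature.MathematicalPhysics.
QuantumFieldTheory.Balaban1983to89`): the carrier `B10.TowerRun` with (41) `B10.Ineq41`, (47) `B10.Ineq47`, Sect. C as
ONE leaf `B10.SectCStepPrinted`, Thm 2 `B10.Thm2Printed` (+ `B10.thm2_of_sections`); the per-step pieces
`B10SectAGathering.StepPieces` with the leaves `Bound55` ((22)/(55)+(58)), `Bound55Lower`, `Cumulant58` ((24)/(58)→(59)),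
`CumulantLower`, `Repr33_60` ((33)/(60)), `VacuumWhole` (p. 265 / p. 270 L31), `Decomp35_61` ((35)/(61)), `Norm35`,
`StarCount`, `OldOutside` (p. 272 L27–29), `PintSucc`, `Estep62` ((36)/(62)), `ZtermSucc`, `RmSucc`, the bundle
`StepLeaves` and `step_of_leaves`/`sectCStep_of_leaves`/`thm2_of_leaves`; the p. 268 nested-minimiser sentence and (52)
at A = 0 `B10NestedMinimizer.StepData` (+ `gauge_Uk_substitute_Usucc`); the enlargement sentence p. 268 L18–22
`B10Eq13Enlargement.claim268_enlarged(_d3)`; (53) `B10SectCExpansion.Line2_53`/`Orthogonality53`/`Expansion53`, (54)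
`QuadForm54`, (56) `Bound56`, (57) `Bound57` (+ `B10Eq57Resummation`); (59) and p. 270 L28–33 `B10Eq59Localization.*`;
(61) per-site `B10Eq61PerSite`/`B10Eq61Leaves`; (63) `B10.logdet63_skeleton`, `B10LogDet63.matrix63`/`log_gaussian_diff61`,
`B10Eq63Contour`, `B10Eq63Rep.G3Rep`; p. 272 exactness `B10Thm2Exactness.oldOutside_*`.  Section §0 below re-exports the
statement-level ones under this namespace (`export`, no new declaration).

WHAT THIS FILE ADDS (the displays of Sect. C that had NO declaration in the tree — checked 2026-08-21 by `lean search`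
and by reading the LQB B10 cluster headers: (48), (49), (50), (51), (52) at general A, (55) and (58) as SEPARATE displays):
* §1 `StepDisplays T k` (extends `StepPieces T k`): names «the first expression (48)» as the outer history functional
  `outer48`, «(The integral (49))» `I49`, the small-field function «χ_{k+1}» of (49)/(51)/(55) `chiNew`, the A-integral on
  the right of (51) `J51`, and the fluctuation integral of (55) `Fl55`; two STRUCTURAL clauses relate them to LQB's
  carrier (`outer48_mono`: the (48)-functional is monotone — it is a sum of integrals against non-negative weights;
  `outer48_chi_exp`: the (48)-functional applied to χ_{k+1}·e^{F} IS the (41)_{k+1} history functional `T.LF (k+1)`).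
* §2 the displays: `Ineq48_49` (p. 267 L33–p. 268 L13: T applied to (41)_k is bounded by the (48)-functional of (49)),
  `Ineq51` ((51) with «g_k sufficiently small» as the binder `T.g k ≤ γ`), `Ineq55` ((55), exponent token by token),
  `Ineq58` ((58)); §3 `ChartData`/`Eq50`/`Eq52` ((50) and (52) as the printed identities, the objects Q of [4] (121),
  D̃ of (17), 𝓗 of [7] (174)–(175), U_k(·), U_{k+1} NAMED, with the printed smallness domains as binders).
* §4 `bound55_of_displays` — [folklore] bookkeeping: `Ineq48_49 ∧ Ineq55 γ ∧ Ineq58 ∧ g_k ≤ γ ⇒ Bound55` (LQB's leaf),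
  i.e. the printed chain (48)–(49) → (55) → (58) lands exactly on the exponent LQB's `StepLeaves.bound55` consumes; so a
  prover who proves the three displays for concrete carriers has proved the leaf.  No content of the series is used.
NOT HERE: (53)–(54), (56)–(57), (59)–(63) (RE-USE, §0); the lower-bound twin of (55) (one printed sentence p. 272 L30–31,
LQB leaf `Bound55Lower`, RE-USE); any construction of the objects (lane seats p1, p4–p6); Sect. D (sibling `…SectD`).
d = 3 is visible in (55) only through LQB's reading `T.mainT (k+1) h V = (1/g_k²)A^η(U_{k+1})` (g_{k+1}² = L·g_k² and
A^{η/L} = L·A^η, p. 265 «g₁ = g(Lε)^{1/2}»), recorded in the docstring of `Ineq55`.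
-/

namespace Literature.MathematicalPhysics.QuantumFieldTheory.Balaban1985CMP102.SectC

open Literature.MathematicalPhysics.QuantumFieldTheory.Balaban1983to89
open Literature.MathematicalPhysics.QuantumFieldTheory.Balaban1983to89.B10 (TowerRun Ineq41 Ineq47)
open Literature.MathematicalPhysics.QuantumFieldTheory.Balaban1983to89.B10SectAGathering (StepPieces Bound55)

/-! ## §0 Re-exports (RE-USE rows of the spine; no new declaration)

**Theorem 2** p. 272 = PDF 18 L35–37, verbatim (render p018): «Theorem 2. The sequence of densities ρ_k defined by the
inductive equations (2), with ρ₀ given by (1), satisfies the inequalities (41), (47).» — `B10.Thm2Printed` (family form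
over `RunData`), with Sect. C as one leaf `B10.SectCStepPrinted` and the assembled forms `B10SectAGathering.thm2_of_leaves`.
(53)–(54) p. 269 L2–8: `B10SectCExpansion.Expansion53`, `QuadForm54`; (56) p. 269 L29–31, (57) p. 270 L14: `Bound56`,
`Bound57`; (58)→(59) p. 270 L23–35: `Cumulant58`; (59)'s terms, p. 270 L36–38 «The terms 𝒫′_{k+1} satisfy the bound (25)
(with the indices 1, 0 replaced by k + 1, k), and are gauge invariant functions of U_{k+1}»: `B10.Bound25Printed` (over
`B10.PolymerActivities`, at g = g_k); (60) p. 271 L11: `Repr33_60`; (61) p. 271 L17: `Decomp35_61`; (62) p. 271 L19: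
`Estep62`; (63) pp. 271–272: `B10.logdet63_skeleton`, `B10LogDet63.matrix63`; p. 272 L27–29: `OldOutside`. -/

export Literature.MathematicalPhysics.QuantumFieldTheory.Balaban1983to89.B10
  (Thm2Printed SectCStepPrinted thm2_of_sections logdet63_skeleton PolymerActivities Bound25Printed)
export Literature.MathematicalPhysics.QuantumFieldTheory.Balaban1983to89.B10SectAGathering
  (Bound55Lower Cumulant58 CumulantLower Repr33_60 VacuumWhole Decomp35_61 Norm35 StarCount OldOutside PintSucc
    Estep62 ZtermSucc RmSucc StepLeaves step_of_leaves sectCStep_of_leaves thm2_of_leaves)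
export Literature.MathematicalPhysics.QuantumFieldTheory.Balaban1983to89.B10SectCExpansion
  (ExpansionData Line2_53 Orthogonality53 Expansion53 QuadForm54 Bound56 Bound57)
export Literature.MathematicalPhysics.QuantumFieldTheory.Balaban1983to89.B10LogDet63 (matrix63 log_gaussian_diff61)

variable {T : TowerRun} {k : ℕ}

/-! ## §1 The printed intermediate objects of the k-th step (p. 268–270) -/

/-- The objects Sect. C prints between (41)_k and (41)_{k+1}, over LQB's carrier (`T : B10.TowerRun`, step `k → k+1`,
histories `T.Hist (k+1)` = the data {Ω_j, Λ_j, Z_j, V_j}_{j ≤ k} summed and integrated over in (41)_{k+1}, new field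
`V : T.Cfg (k+1)`), extending LQB's `StepPieces T k` (|Z_k|, |B(Λ_{k+1})*|, log σ₀, d(𝔤), log Z^{(k)}(B(Λ_{k+1}), U_{k+1}),
the (58) fluctuation logarithm `logFl`, the old interaction terms `Pold`, …).  New NAMES (nothing is constructed):
* `outer48 V G` — **(48)** p. 268 = PDF 14 L10, «∫dV_k↾_{Z_k} δ(V̄_kV^{−1})⋯», «the first expression in the inductive
  formula for k + 1» (L11): the sum over the histories and the integrations of (41)_{k+1} — «Σ_{{Ω_j}} ∫dV_k↾_{Z_k}
  δ(V̄_kV^{−1}) ⋯ ∫dV₀↾_{Z₀} δ(V̄₀V₁^{−1}) ζ_{Λ_k} χ_k ⋯ ζ_{Λ₁} χ₁ ζ_{Ω₁^c}» ((41) p. 266 with p. 268 L4–7: «The partial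
  resummation over admissible P gives the function ζ_{Λ_k} defined on fields V_k restricted to Λ_k», Λ_k = Ω_k^{(k)}∖Ω_{k+1}^{(k)}
  ⊂ Z_k = B(Λ_{k+1})ᶜ) — applied to a history-indexed integrand `G`, WITHOUT the factor χ_{k+1} (print carries χ_{k+1}
  inside (49));
* `chiNew h V` — «χ_{k+1}» (p. 268 L7–8 «the small fields characteristic function on a neighbourhood of B(Λ_{k+1}) allows us
  to introduce the functions χ_{k+1} given by (41) ⟦sic: (40)⟧, with V instead of V_{k+1}»; (40) p. 266: «χ_j = Π_{p∈Λ_j}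
  χ({|V_j(∂p) − 1| < 2L²g_{j−1}p(g_{j−1})})»), a number in [0, 1];
* `I49 h V` — **(49)** p. 268 L12, «χ_{k−1} ⟦sic: χ_{k+1}⟧ ∫dV_k↾_{B(Λ_{k+1})} δ(V̄_kV^{−1}) χ exp[−(1/g_k²)A^η(U_k) + ⋯]»,
  «which we have to calculate. The symbol χ denotes characteristics functions in the decomposition of unity, restricted
  to B(Λ_{k+1}), i.e. determining the small fields restrictions.» (L13–15); «⋯» = the remaining exponent of (41)_k;
* `J51 h V` — the right-hand side of **(51)** p. 268 L31–33 WITHOUT its prefactor χ_{k+1}: «∫dA↾_{B(Λ_{k+1})} det(I −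
  (δ/δA)D̃(A)) × (σ/σ₀)(A − D̃(A)) δ(QA) δ_{Ax}(A) χ × exp[−(1/g_k²)A^η(U_k(exp i(A − D̃(A))V_k^{(k)})) + ⋯ + log σ₀|B(Λ_{k+1})*|]»,
  «where χ = Π_{b∈B(Λ_{k+1})} χ({|A(b)| < g_kp²(g_k)}), g_k sufficiently small, |B(Λ_{k+1})*| has the same meaning as |Ω₁*| in
  the first step» (L34–35);
* `Fl55 h V` — the last factor of **(55)** p. 269 L13–17: «∫dμ_{C^{(k)}(B(Λ_{k+1}),U_{k+1})}(A) χ exp[v(g_kA) − (1/g_k²)Ṽ(g_kA)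
  + Σ_{j=1}^k Σ_{Y_j} 𝒫_j(Y_j, exp iη𝓗(g_kA − D̃(g_kA))U_{k+1}) + (the constants in (41))]».
Structural clauses (the only axioms of the carrier; both are identities/monotonicity of sums of integrals against
non-negative weights, as for LQB's `TowerRun.lf_mono`): `outer48_mono`; `outer48_chi_exp` — the (48)-functional of
`χ_{k+1}·exp F` is the (41)_{k+1} history functional `T.LF (k+1) V F` of LQB (p. 271 L13–15 «we obtain the inductive
inequality (41) for k replaced by k + 1»); `chiNew_nonneg`, `chiNew_le_one` (a characteristic function).
[cite: Balaban1985UV3, (48)–(49) p.268, (51) p.268, (55) p.269] -/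
structure StepDisplays (T : TowerRun) (k : ℕ) extends StepPieces T k where
  outer48 : T.Cfg (k + 1) → (T.Hist (k + 1) → ℝ) → ℝ
  outer48_mono : ∀ (V : T.Cfg (k + 1)) (G G' : T.Hist (k + 1) → ℝ),
    (∀ h, G h ≤ G' h) → outer48 V G ≤ outer48 V G'
  chiNew : T.Hist (k + 1) → T.Cfg (k + 1) → ℝ
  chiNew_nonneg : ∀ h V, 0 ≤ chiNew h V
  chiNew_le_one : ∀ h V, chiNew h V ≤ 1
  outer48_chi_exp : ∀ (V : T.Cfg (k + 1)) (F : T.Hist (k + 1) → ℝ),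
    outer48 V (fun h => chiNew h V * Real.exp (F h)) = T.LF (k + 1) V F
  I49 : T.Hist (k + 1) → T.Cfg (k + 1) → ℝ
  J51 : T.Hist (k + 1) → T.Cfg (k + 1) → ℝ
  Fl55 : T.Hist (k + 1) → T.Cfg (k + 1) → ℝ

/-! ## §2 The displayed inequalities (48)–(49), (51), (55), (58) -/

/-- **(48)–(49)**, p. 267 = PDF 13 L33–36 and p. 268 = PDF 14 L1–13, verbatim: «We apply the renormalization transformation
T to the density ρ_k, and we use the inductive inequality (41). Thus the density ρ_{k+1} is bounded by a sum of terms
obtained by application of the renormalization transformation T to terms on the right-hand side of (41). Now we do the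
same operations as in the first step. We introduce the decomposition of unity (7) for the field V on the domain Λ_k, with
ε₁ = g_kp(g_k). Let us denote the field variables V by V_k, and the new fields by V. We define the set Ω^{(k)}_{k+1} as a
union of big blocks of the lattice T₁^{(k)}, with distances to P ∪ Ω_k^{(k)c} greater than R(g_k)M₁. We change the
definition of Λ_k, taking Λ_k = Ω_k^{(k)}∖Ω^{(k)}_{k+1}, and we define Λ_{k+1} = Ω^{(k+1)}_{k+1}, hence Ω^{(k)}_{k+1} =
B(Λ_{k+1}). … We decompose the integral over V_k into two parts. The first is simply the integral restricted to Z_k =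
B(Λ_{k+1})ᶜ, hence it defines the first expression (48) ∫dV_k↾_{Z_k} δ(V̄_kV^{−1})⋯ in the inductive formula for k + 1.
The second gives the integral (49) χ_{k−1} ⟦sic: χ_{k+1}⟧ ∫dV_k↾_{B(Λ_{k+1})} δ(V̄_kV^{−1}) χ exp[−(1/g_k²)A^η(U_k) + ⋯],
which we have to calculate.»  Typed reading: GIVEN (41)_k, ρ_{k+1} = Tρ_k is bounded by the (48)-functional applied to
«(The integral (49))».  Hypothesis-shaped; its printed proof is the quoted paragraph ((2), (7)–(8) at scale k, Fubini).
[cite: Balaban1985UV3, (48)–(49) pp.267–268] -/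
def Ineq48_49 (S : StepDisplays T k) : Prop :=
  Ineq41 T k → ∀ V : T.Cfg (k + 1), T.ρ (k + 1) V ≤ S.outer48 V (fun h => S.I49 h V)

/-- **(51)**, p. 268 = PDF 14 L15–35, verbatim: «The integral (49) is calculated by the saddle point method. We take the
minimal configuration V_k^{(k)} of the functional A^η(U_k), which satisfies the conditions V_k^{(k)}↾_{Z_k} = V_k↾_{Z_k},
\overline{V_k^{(k)}} = V on Λ_{k+1}. If we substitute it in U_k in place of V_k↾_{Λ_k}, we get the configuration U_{k+1}.
We introduce the gauge fixing terms δ_{Ax(B(Λ_{k+1}))}(V_k) using (9), and we make the translation V_k = V′_kV_k^{(k)}. The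
restrictions on V_k and V_k^{(k)} imply that the configuration V′_k − 1 is small, more exactly |V′_k − 1| <
16·3²L²B₃g_kp(g_k). The integration is expressed now in terms of the variables V′_k = e^{iA′}. We enlarge the region of
integration to all configurations V′_k satisfying |A′| < 32·3²L²B₃g_kp(g_k), and we denote by χ′ the characteristic
function of this region. … Next we do the same operations as in the first step, and we obtain the inequality
(51) (The integral (49)) ≤ χ_{k+1} ∫dA↾_{B(Λ_{k+1})} det(I − (δ/δA)D̃(A)) × (σ/σ₀)(A − D̃(A)) δ(QA) δ_{Ax}(A) χ
× exp[−(1/g_k²)A^η(U_k(exp i(A − D̃(A))V_k^{(k)})) + ⋯ + log σ₀|B(Λ_{k+1})*|], where χ = Π_{b∈B(Λ_{k+1})} χ({|A(b)| <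
g_kp²(g_k)}), g_k sufficiently small, |B(Λ_{k+1})*| has the same meaning as |Ω₁*| in the first step.»  «g_k sufficiently
small» is the binder `T.g k ≤ γ` (γ a smallness threshold the prover supplies).  LQB records of the quoted steps (RE-USE):
nested minimiser `B10NestedMinimizer.StepData`, the bound |V′_k − 1| < 16·3²L²B₃g_kp(g_k) = Lemma 1 of [6] with α₁ = 0
(`B10Eq13RegularityClaims.claim268`, `B10.edge_B8Lemma1_alpha1_zero`), the enlargement `B10Eq13Enlargement.claim268_enlarged_d3`,
D̃ of (17) `B10SectAStatements.Eq17`, the Jacobian (20)–(21) `B10Eq20Locality`.  Hypothesis-shaped. [cite: Balaban1985UV3, (51) p.268] -/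
def Ineq51 (S : StepDisplays T k) (γ : ℝ) : Prop :=
  T.g k ≤ γ → ∀ (h : T.Hist (k + 1)) (V : T.Cfg (k + 1)), S.I49 h V ≤ S.chiNew h V * S.J51 h V

/-- **(55)**, p. 269 = PDF 15 L8–17, verbatim: «Denoting the expression in curly brackets {⋯} in (53) by Ṽ(A), using the
definition (3.155) [5], the equalities (20), (21), the definition of v(A), and doing the transformation A → g_kA in the
integral, we obtain (55) (The integral (49)) ≤ χ_{k+1} exp[−(1/g_k²)A^η(U_{k+1}) − E_k + log σ₀|B(Λ_{k+1})*| +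
d(𝔤) log g_k|B(Λ_{k+1})*| + log Z^{(k)}(B(Λ_{k+1}), U_{k+1})] × ∫dμ_{C^{(k)}(B(Λ_{k+1}),U_{k+1})}(A) χ exp[v(g_kA) −
(1/g_k²)Ṽ(g_kA) + Σ_{j=1}^k Σ_{Y_j} 𝒫_j(Y_j, exp iη𝓗(g_kA − D̃(g_kA))U_{k+1}) + (the constants in (41))].»  Token map onto
the carrier: «−(1/g_k²)A^η(U_{k+1})» = `−T.mainT (k+1) h V` (LQB's reading, see `B10SectAGathering.Bound55`: after the
rescaling to the next unit lattice g_{k+1}² = L·g_k² and A^{η/L} = L·A^η in d = 3, so the main term of (41)_{k+1} equals the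
printed one; p. 265 L20 «where g₁ = g(Lε)^{1/2}»); «−E_k» = `−T.Ecst k`; «log σ₀|B(Λ_{k+1})*|» = `S.logσ₀ * S.starB h`;
«d(𝔤) log g_k|B(Λ_{k+1})*|» = `S.dg * log (T.g k) * S.starB h`; «log Z^{(k)}(B(Λ_{k+1}), U_{k+1})» = `S.logZU h V`; the
last integral = `S.Fl55 h V`.  «g_k sufficiently small» inherited from (51): binder `T.g k ≤ γ`.  Printed proof = (50),
(52)–(54) with [7] (26), (74), (78)–(81), (174)–(175) and [5] (3.155)–(3.156) (RE-USE rows `Eq50`, `Eq52`, `Expansion53`,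
`QuadForm54`; binders b9, b11).  Hypothesis-shaped. [cite: Balaban1985UV3, (55) p.269] -/
def Ineq55 (S : StepDisplays T k) (γ : ℝ) : Prop :=
  T.g k ≤ γ → ∀ (h : T.Hist (k + 1)) (V : T.Cfg (k + 1)),
    S.I49 h V ≤ S.chiNew h V *
      Real.exp (-(T.mainT (k + 1) h V) - T.Ecst k + S.logσ₀ * S.starB h
        + S.dg * Real.log (T.g k) * S.starB h + S.logZU h V) * S.Fl55 h V

/-- **(58)**, p. 269 = PDF 15 L18–p. 270 = PDF 16 L23, verbatim frame: «Now we repeat again the operations of the first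
step. We expand the functions in the last exponential above up to the sixth order in g_k, and we estimate the remainder.
… The remainders for both expressions are estimated by O(g⁷p¹⁸(g_k)) ⟦sic: g_k⁷⟧ |B(Λ_{k+1})| ≤ O((L^kε)^{3+κ₀})|T₁^{(k)}|.
… (56) … (57) … We sum up all the coefficients at the same monomial in A. We get a coefficient which, by bound similar to
(45), (46), can be estimated as in (56) (with O(g_k^m)). Thus these expansions and resummations give a non-local
polynomial 𝒱(A), whose terms are described by (56). The integral on the right-hand side of (55) is estimated by
(58) exp[Σ_{j=1}^k Σ_{Y_j} 𝒫_j(Y_j, U_{k+1}) + (the constants in (41))] × ∫dμ_{C^{(k)}}(A) χ exp[𝒱(A) +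
O((L^kε)^{3+κ₀})|T₁^{(k)}|].»  Token map: «Σ_{j=1}^k Σ_{Y_j} 𝒫_j(Y_j, U_{k+1})» = `S.Pold h V`; «(the constants in (41))» =
the Z-terms and remainders of (41)_k at the projected k-history, `T.Zterm k (S.proj h) + T.Rm k` (E_k is displayed
separately in (55)); the last integral = `exp (S.logFl h V)` (LQB's `StepPieces.logFl` is its logarithm — the quantity the
leaf `Cumulant58` then bounds by (59)).  Printed proof: the sixth-order expansions with (56)–(57) (RE-USE `Bound56`, `Bound57`,
`B10SectAGathering.remainder_powerCounting`).  Hypothesis-shaped. [cite: Balaban1985UV3, (58) p.270] -/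
def Ineq58 (S : StepDisplays T k) : Prop :=
  ∀ (h : T.Hist (k + 1)) (V : T.Cfg (k + 1)),
    S.Fl55 h V ≤ Real.exp (S.Pold h V + (T.Zterm k (S.proj h) + T.Rm k)) * Real.exp (S.logFl h V)

/-! ## §3 The chart identities (50) and (52) -/

/-- The objects of **(50)** p. 268 and **(52)** pp. 268–269 NAMED (nothing constructed), for one step k, one history and
one new field V: `BondF` = bonds of B(Λ_{k+1}) ⊂ T₁^{(k)} (where V_k, V′_k, V_k^{(k)}, A, A′ live), `BondC` = bonds of
Λ_{k+1} ⊂ T₁^{(k+1)} (where V and the averages V̄ live), `BondX` = bonds of the η-lattice (where U_k, U_{k+1}, 𝓗 live);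
`G` the gauge group (a parameter, with its group law) and `expG A = exp(iA)` from the Lie algebra `𝔤` (a parameter); `bar` = the averaging operation V ↦ V̄ of [4]
((2): «the renormalization transformations T described in [1, 4]»); `dbar W` = «V̿′_k», the average (89) of [4] of the
fluctuation W at the background V_k^{(k)} with the axial gauge fixing conditions of (49) (as in (14) p. 259: «the second
equality follows from the definition (89) (or (63)) in [4], and the gauge fixing conditions»); `Q` = «Q(A′)» = the
function Q(V_k^{(k)}, A′, ·) of Proposition 3 [4] ((121) p. 36 of [4]; LQB `B7Eq92Concrete.dbavgCov`,
`B7Prop3GeneralAnalytic.analyticAt_mlog_dbavgCov_expCfg`); `Vkk` = V_k^{(k)} (p. 268 L15–17; LQB `B10NestedMinimizer.StepData`);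
`small50 A′` = «|A′| < 32·3²L²B₃g_kp(g_k)» (p. 268 L21); `Dt` = D̃ of (17) (LQB `B10SectAStatements.Eq17`); `Uk W` =
U_k with V_k↾_{B(Λ_{k+1})} replaced by W (history and V_k↾_{Z_k} fixed; (42) p. 266); `Usucc` = U_{k+1} (p. 268 L17);
`eta` = η = L^{−k}; `calH` = «𝓗(B) is determined by Eqs. (174), (175) [7]» (LQB `B11Eq174Chart.chartH`); `Gauge` = «(modulo
a gauge transformation)»; `small52 A` = «|A(b)| < g_kp²(g_k)» for b ∈ B(Λ_{k+1}) (the χ of (51)).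
[cite: Balaban1985UV3, (50) p.268, (52) pp.268–269] -/
structure ChartData (𝔤 : Type) [AddCommGroup 𝔤] [Module ℝ 𝔤] (G : Type) [Group G] where
  BondF : Type
  BondC : Type
  BondX : Type
  expG : 𝔤 → G
  bar : (BondF → G) → (BondC → G)
  dbar : (BondF → G) → (BondC → G)
  Q : (BondF → 𝔤) → (BondC → 𝔤)
  Vkk : BondF → G
  small50 : (BondF → 𝔤) → Prop
  Dt : (BondF → 𝔤) → (BondF → 𝔤)
  Uk : (BondF → G) → (BondX → G)
  Usucc : BondX → G
  eta : ℝ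
  calH : (BondF → 𝔤) → (BondX → 𝔤)
  Gauge : (BondX → G) → (BondX → G) → Prop
  small52 : (BondF → 𝔤) → Prop

/-- **(50)**, p. 268 = PDF 14 L26–29, verbatim: «For the expressions in δ-functions in (49) we have the formula analogous to
(14), (50) \overline{(V′_kV_k^{(k)})}\,(\overline{V_k^{(k)}})^{−1} = V̿′_k = exp iQ(A′), the only difference is that the
configuration U₁ is replaced by V_k^{(k)}, which has the same properties as U₁.» ((14) p. 259 L25–29: «(\overline{U′U₁})(\overline{U₁})^{−1}
= Ũ′ = U̿′ = exp iQ(A′), where the second equality follows from the definition (89) (or (63)) in [4], and the gauge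
fixing conditions. Properties of the function Q(A′) = Q(U₁, A′) were described in Proposition 3 [4]».)  Typed: for every A′ in the
enlarged region, with V′_k = exp(iA′) bondwise, BOTH printed equalities.  Hypothesis-shaped (it is the definition (121) of
[4] of Q at the background V_k^{(k)} plus the gauge-fixing identification; binder b7 = [4] Prop 3 p. 36).
[cite: Balaban1985UV3, (50) p.268] -/
def Eq50 {𝔤 : Type} [AddCommGroup 𝔤] [Module ℝ 𝔤] {G : Type} [Group G] (C : ChartData 𝔤 G) : Prop :=
  ∀ A' : C.BondF → 𝔤, C.small50 A' →
    (fun c => C.bar (fun b => C.expG (A' b) * C.Vkk b) c * (C.bar C.Vkk c)⁻¹) = C.dbar (fun b => C.expG (A' b)) ∧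
      C.dbar (fun b => C.expG (A' b)) = fun c => C.expG (C.Q A' c)

/-- **(52)**, p. 268 = PDF 14 L35–p. 269 L1, verbatim: «Now we expand the action in A. Using the results of Sect. G [7] we
write (52) U_k(exp i(A − D̃(A))V_k^{(k)}) = exp iη𝓗(A − D̃(A))U_{k+1} (modulo a gauge transformation), where 𝓗(B) is
determined by Eqs. (174), (175) [7].»  Typed: for every A in the small-field region of (51), the two η-lattice configurations
are gauge equivalent, with «exp iη𝓗(B)» the bondwise exponential of η·𝓗(B).  Its instance A = 0 (U_k(V_k^{(k)}) = U_{k+1}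
modulo gauge) is LQB's `B10NestedMinimizer.StepData.gauge_Uk_substitute_Usucc`; 𝓗 is LQB's `B11Eq174Chart.chartH` over
the abstract scheme of [7] (binder b11 = [7] Sect. G (174)–(175) p. 305, Prop 9 p. 309).  Hypothesis-shaped.
[cite: Balaban1985UV3, (52) pp.268–269] -/
def Eq52 {𝔤 : Type} [AddCommGroup 𝔤] [Module ℝ 𝔤] {G : Type} [Group G] (C : ChartData 𝔤 G) : Prop :=
  ∀ A : C.BondF → 𝔤, C.small52 A →
    C.Gauge (C.Uk fun b => C.expG ((A - C.Dt A) b) * C.Vkk b)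
      (fun x => C.expG (C.eta • C.calH (A - C.Dt A) x) * C.Usucc x)

/-! ## §4 The printed chain (48)–(49) → (55) → (58) lands on LQB's leaf `Bound55` -/

/-- [folklore] exponent bookkeeping, kernel-checked: the displays (48)–(49), (55), (58) at a step with «g_k sufficiently
small» (`T.g k ≤ γ`) imply LQB's leaf `B10SectAGathering.Bound55` for the underlying `StepPieces` — (48)-monotonicity,
`χ_{k+1} ≤ 1`-free (χ_{k+1} is kept, `outer48_chi_exp`), `exp a · exp b = exp (a + b)`.  So `StepLeaves.bound55` for a
concrete carrier follows from proofs of `Ineq48_49`, `Ineq55`, `Ineq58`.  No content of the series.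
[cite: Balaban1985UV3, (48)–(58) pp.268–270] -/
theorem bound55_of_displays (S : StepDisplays T k) {γ : ℝ} (hγ : T.g k ≤ γ)
    (h48 : Ineq48_49 S) (h55 : Ineq55 S γ) (h58 : Ineq58 S) : Bound55 S.toStepPieces := by
  intro h41 V
  refine (h48 h41 V).trans ?_
  rw [← S.outer48_chi_exp]
  refine S.outer48_mono V _ _ fun h => ?_
  have h1 := h55 hγ h V
  have h2 := h58 h V
  have hpre : 0 ≤ S.chiNew h V *
      Real.exp (-(T.mainT (k + 1) h V) - T.Ecst k + S.logσ₀ * S.starB h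
        + S.dg * Real.log (T.g k) * S.starB h + S.logZU h V) :=
    mul_nonneg (S.chiNew_nonneg h V) (Real.exp_pos _).le
  refine h1.trans ((mul_le_mul_of_nonneg_left h2 hpre).trans (le_of_eq ?_))
  rw [mul_assoc, ← Real.exp_add, ← Real.exp_add]
  congr 2
  ring

end Literature.MathematicalPhysics.QuantumFieldTheory.Balaban1985CMP102.SectC
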